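import Literature.MathematicalPhysics.QuantumFieldTheory.Balaban1983to89.B9Thm32CinvAtKnitLetterOfCubeData
import Literature.MathematicalPhysics.QuantumFieldTheory.Balaban1983to89.B9Thm32CinvAtMemberOfCubeDataThmD

/-!
# `Balaban1983to89.B9Thm32CinvAtKnitLetterOfCubeDataThmD` — [B9] THEOREMS 3.7 + 3.9 + «THEOREM D» ⇒ THEOREM 3.2 (3.48) p. 398 FOR `C(U) = (Q′G′²Q′*)⁻¹(U)` AT
# PRINT's KNIT LETTER `parKnitY`, AT A `U(N)`-VALUED (3.35)-REGULAR BACKGROUND OF THE CLASS (52), FOR EVERY MEMBER ABOVE ONE THRESHOLD, FROM THE PER-CUBE (3.35)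
# DATA — THE DISPLAYED [2]-DIFFERENCE MAJORANT `hD` OF FILE 10 ∕ FILE 11 DISCHARGED BY p21's `B9ThmDAtDatum.thmD_cover_binders` (sub-row G-B9-LETTERS, modules
# M5.1b-G′ × M5.2-E × M5.6 × Thm D; FILE 14 of seat p33 = the «hDf plug» at the knit letter, consuming p21's member-level plug `B9Thm32CinvAtMemberOfCubeDataThmD` BY NAME)

T. Bałaban, *Propagators for lattice gauge theories in a background field*, Commun. Math. Phys. **99** (1985) 389–434
[`Balaban1985BackgroundPropagators`, "B9"]; [2] = T. Bałaban, *Regularity and decay of lattice Green's functions*, Commun. Math. Phys. **89** (1983)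
571–597 [`Balaban1983RegularityDecay`]; [4] = T. Bałaban, *Propagators and renormalization transformations for lattice gauge theories. II*, Commun.
Math. Phys. **96** (1984) 223–250 [`Balaban1984PropagatorsII`]; T. Bałaban, *Averaging operations for lattice gauge theories*, Commun. Math. Phys. **98**
(1985) 17–51 [`Balaban1985Averaging`, "B7"] for the class (52).

statement-level skeleton of published theorems with citation tags; proofs where landed; nothing here is a claim about the
Yang–Mills mass gap

THE PRINTED LOCUS (verbatim, held `paper:balaban1985-cmp99-background-propagators`, journal page = PDF page + 388).  Thm 3.2 (3.48) p. 398; p. 409 l. 1–5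
(«the sequence {Ω_n(□)} satisfies the assumptions of Corollary 3.6 … C_□(U) = (Q′(U)G′²_□(U)Q′*(U))⁻¹ … satisfy all the inequalities of Theorems 3.1–3.3»);
p. 411 (3.95)–(3.96) «By the same estimates as in [4], especially (2.83)–(2.85), we can see that the operator R is small and (Q′G′²Q′*)⁻¹ = C₀(I − R)⁻¹ = Σ C₀Rⁿ»;
p. 412 l. 1–9 («the operators may differ outside □̃₀ … using the results of [2] … e^{−2δ₀M}» — the localized [2]-difference, Theorem D); (3.97) p. 412; p. 413
Thm 3.9 «For M sufficiently large … This theorem implies Theorem 3.2»; Thm 3.7 pp. 409–410; Cor. 3.6 p. 408; (3.19) p. 393 (the knit transporters); Thm 3.11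
p. 416; [2] Thm (5.8) p. 594; [4] Lemma 2.1 (2.60)–(2.67) p. 234, (2.83)–(2.87) pp. 237–238; [B7] (52)–(53) pp. 26–27.

WHY THIS FILE.  FILE 11 `B9Thm32CinvAtKnitLetterOfCubeData.cinv_at_knit_member_of_cubeData_unitary` is Theorem 3.2 (3.48) for `C(U)` at print's knit letter
for every member above one threshold, every `U(N)`-valued `U` of the class (52) carrying per-cube (3.35) data — MODULO the localized [2]-difference majorants
`hD` of p. 412 (cell GAPS G-B9-05), displayed there (as in FILE 10) as a rate function with Theorem D's constants `κ_D ≥ 0`, `δ_D > 0` as head PARAMETERS.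
p21's D6 `B9ThmDAtDatum.thmD_cover_binders` (ACCEPTED p651137, 2026-08-28) PROVES that rate function for every cube from the SAME per-cube (3.35) data
family, and p21's member-level plug `B9Thm32CinvAtMemberOfCubeDataThmD` (ACCEPTED p652125) packages it per member as ★★★ `hDf_of_cubeData_unitary` — FILE 10's ∕
FILE 11's displayed `hD` in their VERBATIM shape (existential `δ_D, κ_D`, thresholds, `a₁` before the member; inside: FILE 9 `eBlock_GpY_of_cubeData_unitary` →
D1-READ `hasMajorant_conj_G_of_eBlockInv` + Thm 3.11 `isUnit_deltaPrimeAY_parSymY` + unitarity → D6) — next to the member-level statement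
`cinv_at_member_of_cubeData_thmD`.  THIS FILE is the knit-letter twin (one typist per junction; p21's supplier consumed BY NAME, nothing re-derived):
★★★ `cinv_at_knit_member_of_cubeData_unitary_thmD` — FILE 11's statement VERBATIM MINUS the head parameters `{κD δD} (hκD) (hδD)` and MINUS the hypothesis
`hD`: THEOREMS 3.7 + 3.9 + D ⟹ THEOREM 3.2 (3.48) `conj b((η²η²)⁻¹•(Q′G′²Q′*)⁻¹(U; parKnitY)) ≺ K·(ℓ(a)⁴)⁻¹·e^{−δd}` for every member above ONE threshold with
`c_f = L^k`, every `G`-valued `U` (`G ≤ U(N)` averaging-closed) with `pdev (liftCfg U) < α₀′(L^k)⁻²`, `0 < α₀′ ≤ a₀`, carrying (3.35) data on every cube — the data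
family, the section `ιB` and a background family through `U` displayed, NOTHING ELSE.  With FILE 12 (`B9Thm31GpAtKnitLetterOfCubeData`, the `G′`-line) and
FILE 13 (`B9Thm31GradGpAtKnitLetterOfCubeData`, the gradient line) all three `KnitMajorants` letters `hGm`, `hDG`, `hC` of the [B8] Thm 2 torus assembler
(`B8Thm2TorusKnitEstimatesOfMajorants`) are now theorem-fed from ONE per-cube (3.35) datum family + the class (52).

HONEST SCOPE / NOT CLAIMED.  Composition of landed theorems with threshold bookkeeping; NO estimate of [B9] is proved here.  DISPLAYED (exactly FILE 11's list
minus `hD`): the per-cube (3.35) data family in p33's unpacked form (bi-contractive gauges `u_□`, potentials `A_□` on torus sets `Q_□ ⊇ NearC_□(35S_j∕8 + 1)` —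
which class cube supplies them is FILE 4's open question (Q1)), the member thresholds (existential, «For M sufficiently large»), the (3.37) smallness
`α₁(□) ≤ min(a₁, 1∕4)`, `c_f = L^k`, the section `ιB`, `N ≥ 1`, a real basis `b` of `M_N(ℂ)` with coordinate bound `M₂`, the class-(52) size `α₀′ ≤ a₀` with
`C₀α₀′ ≤ ⅓`, `2α₀′ ≤ c₂′`, and a background family `cfg` through `U` (bookkeeping device of the `EBlock` currency; any family with `cfg U₁ = U`).  DESIGN constants
(not printed constants): FILE 11's `K = 2K_Tc₁(r∕2⁷, ½)`, `δ = r∕2⁸`, `r = min(δ_G, δ_T)` where now `δ_T = min(δ_G, δ_C, δ_D)∕32` carries Theorem D's PROVED rate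
`δ_D` (D6: `δ_D = r_D∕16` at D5's ladder) — print's «a decay rate arbitrarily close» is not pursued.  Theorem D is consumed in D6's labelled form (its deviation
from p. 412 ∕ [2] Sect. 5: the (R)-design cube letters of GAPS G-B9-p21-01 and the cut-off plateau radii of FILE 4 — nothing fails as printed).  Sup-entry (3.48)
only; finite 𝕋 members of the k-level V1 family; count-neutral; no summit ∕ sub-problem statement is proved; nothing continuum ∕ OS ∕ mass-gap ∕ Clay; NOT a
node discharge.  No `sorry`, no `axiom`, no `… : Prop` fact, no `instance`, no `notation`, no `def`.  NEW file; nothing landed is modified.  Cell `lit-balaban`,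
seat `lit-balaban-p33` gen 99, 2026-08-28; `--supports stmt-QuantumFields-19200` as helper.  Net new unproved facts: 0.

RELATED IN THE TREE, NOT DUPLICATED (searched 2026-08-28: `lean search 'knit_member_of_cubeData_unitary_thmD|CinvAtKnitLetterOfCubeDataThmD' --decl` = ∅; the gate's
dedup named p21's `hDf_of_cubeData_unitary` — imported, not restated): FILE 11 (USED, the engine at the knit letter), p21's `B9Thm32CinvAtMemberOfCubeDataThmD`
(USED: the supplier `hDf_of_cubeData_unitary`; its `cinv_at_member_of_cubeData_thmD` is the member-level twin), FILE 10 `B9Thm32CinvAtMemberOfCubeData`, D6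
`B9ThmDAtDatum`, FILE 9 `B9Cor36GpCoverBindersUnitary`, FILE 12 ∕ FILE 13 (the two other knit letters, already unconditional in Theorem D).
-/

noncomputable section

open scoped BigOperators Matrix Matrix.Norms.L2Operator

namespace Literature.MathematicalPhysics.QuantumFieldTheory.Balaban1983to89.B9Thm32CinvAtKnitLetterOfCubeDataThmD

open B4PartitionUnity22 (thetaProf D1)
open B9Eq39Adjoint (fluct covD)
open B6KLevelCensusIndexV1 (KIdx kGeo)
open B6Cover236MultiLevelBlocks (cubes)
open B6GlobalChartV1 (PV boxEquiv)
open B6Ineq2142KLevelV1 (β)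
open B6RandomWalk (HasMajorant)
open B9BackgroundsKLevelV1 (shiftsV1)
open B9Eq352DivFormLetters (conj)
open B9Eq360DeltaPrimeAY (AfldY)
open B9CubeGeometryInputs (RM1)
open B9GeoNormsKLevelV1 (geo9K)
open B9Thm34Ext (toB6)
open B9Cor36CubeCutoffs (SC NearC)
open B9Thm32CinvAtKnitLetterOfCubeData (cinv_at_knit_member_of_cubeData_unitary)
open B9Thm32CinvAtMemberOfCubeDataThmD (hDf_of_cubeData_unitary)
open B7Prop2Explicit (AvgClosed pdev C0 c2' unitaryUnits)
open B9B8CarrierDictionary (liftCfg)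
open B9B8AveragingJunction (parKnitY)
open Node00 (BlkY CfgY GaugeY IBondY toKT gaugeY XinvY GpY etaS)

variable {d ℓ : ℕ} {hd : 1 ≤ d + 1} {hL : Odd (ℓ + 1) ∧ 1 < ℓ + 1} {b₀ b₁ : ℝ}

section Main

variable {N : ℕ} {G : Subgroup (Matrix (Fin N) (Fin N) ℂ)ˣ}
variable {ι : Type} [Fintype ι] [DecidableEq ι] (b : Module.Basis ι ℝ (Matrix (Fin N) (Fin N) ℂ))

/-! ## ★★★ Theorem 3.2 (3.48) for `C(U)` at print's knit letter, from the cube data and the class (52) — Theorem D discharged -/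

/-- ★★★ **THEOREMS 3.7 + 3.9 + D ⇒ THEOREM 3.2 (3.48) FOR `C(U) = (Q′G′²Q′*)⁻¹(U)` AT PRINT's KNIT LETTER, AT A `U(N)`-VALUED (3.35)-REGULAR BACKGROUND OF THE
CLASS (52), FOR EVERY MEMBER ABOVE ONE THRESHOLD, FROM THE PER-CUBE (3.35) DATA — UNCONDITIONAL** (FILE 11 `cinv_at_knit_member_of_cubeData_unitary` at
Theorem D's constants `(κ_D, δ_D)` of p21's supplier `B9Thm32CinvAtMemberOfCubeDataThmD.hDf_of_cubeData_unitary`, its displayed `hD` fed by that supplier): for `G ≤ U(N)` averaging-closed, `N ≥ 1`, the walk data `(Rr, Hp)` and a real basis `b`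
of `M_N(ℂ)` with coordinate bound `M₂` there are `δ > 0`, `K ≥ 0`, thresholds `M₀, T₀, N₀`, `a₁ > 0` and `a₀ > 0` such that for every `0 < α₀′ ≤ a₀` with
`C₀α₀′ ≤ ⅓`, `2α₀′ ≤ c₂′`, every member above the thresholds with `c_f = L^k`, every section `ιB`, every `G`-valued `U` with `pdev (liftCfg U) < α₀′(L^k)⁻²`, every
family of per-cube (3.35) data — bi-contractive gauges `u_□`, potentials `A_□` on torus sets `Q_□ ⊇ NearC_□(35S_j∕8 + 1)` with `U^{u_□} = e^{iηA_□}` on their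
bonds, `‖A_□‖ ≦ C_□ξ_□⁻¹`, `‖η⁻¹∂A_□‖ ≦ C_□ξ_□⁻²`, `0 < ξ_□ ≦ 5S_jη`, `L^{j+1}η ≦ Λ_□ξ_□`, `1 ≦ Λ_□`, `max C_□ (C_□(1+D₁θ))Λ_□² ≦ min(a₁, 1∕4)` — and every
background family through `U`: `conj b((η²η²)⁻¹•(Q′G′²Q′*)⁻¹(U; parKnitY)) ≺ K·(ℓ(a)⁴)⁻¹·e^{−δ·d(a,a′)}` on the block carrier `(s, j) ↦ ιB s`.
DESIGN CONSTANTS (not printed constants): FILE 11's `K`, `δ`, `a₀` at `δ_T := min(δ_G, δ_C, δ_D)∕32` with Theorem D's proved `(κ_D, δ_D)`; they depend on `d`,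
`L = ℓ+1`, `M₂Σ_j‖b_j‖`, FILE 9's `K_G, δ_G`, E2-6's `δ_C`, D6's `κ_D, δ_D` and the member family's (2.61) constants `c₁` at FILE 11's ladder rates — on nothing else.
[cite: Balaban1985BackgroundPropagators, Thm 3.2 (3.48) p.398 + (3.19) p.393 + Thm 3.1 (3.42) p.397 + Thm 3.9 p.413 + (3.95)–(3.97) pp.411–412 + p.412 l.1–9 + Thm 3.7 pp.409–410 + Cor. 3.6 p.408 + Thm 3.11 p.416; Balaban1983RegularityDecay, Thm (5.8) p.594; Balaban1984PropagatorsII, (2.50)–(2.52) p.232 + Lemma 2.1 (2.60)–(2.67) p.234 + (2.83)–(2.85) p.237; Balaban1985Averaging, (52)–(53) pp.26–27] -/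
theorem cinv_at_knit_member_of_cubeData_unitary_thmD [Nonempty (Fin N)] [∀ i' : KIdx d ℓ hd hL b₀ b₁, Fintype (geo9K i').Site]
    [∀ i' : KIdx d ℓ hd hL b₀ b₁, DecidableEq (geo9K i').Site] (hG : G ≤ unitaryUnits (Matrix (Fin N) (Fin N) ℂ)) (hGa : AvgClosed (d + 1) (ℓ + 1) G)
    (Rr : KIdx d ℓ hd hL b₀ b₁ → ℝ) (Hp : KIdx d ℓ hd hL b₀ b₁ → Prop)
    (hℓ : 1 ≤ ℓ) {M₂ : ℝ} (hM₂ : 0 ≤ M₂) (hrepr : ∀ (v : Matrix (Fin N) (Fin N) ℂ) (j : ι), |b.repr v j| ≤ M₂ * ‖v‖) :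
    ∃ δ K M₀ T₀ : ℝ, ∃ N₀ : ℕ, 0 < δ ∧ 0 ≤ K ∧ ∃ a₁ : ℝ, 0 < a₁ ∧ ∃ a₀ : ℝ, 0 < a₀ ∧
    ∀ (α₀' : ℝ), 0 < α₀' → α₀' ≤ a₀ → C0 (d + 1) * α₀' ≤ 1 / 3 → 2 * α₀' ≤ c2' (d + 1) (ℓ + 1) →
    ∀ (i : KIdx d ℓ hd hL b₀ b₁),
      M₀ ≤ ((ℓ : ℝ) + 1) * (toKT i).Mh → N₀ + 1 ≤ (toKT i).R * ((ℓ + 1) * (toKT i).Mh) → T₀ ≤ RM1 i → i.cf = (((ℓ + 1 : ℕ) : ℝ)) ^ i.k →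
    ∀ (ιB : BlkY i → IBondY i), (∀ s, β i.hN i.D i.hk (ιB s) = s) →
    ∀ (U : CfgY (Matrix (Fin N) (Fin N) ℂ) i), (∀ μ x, U μ x ∈ G) → pdev (liftCfg U) < α₀' * ((((ℓ + 1 : ℕ) : ℝ) ^ i.k)⁻¹) ^ 2 →
    ∀ (g : ↥(cubes (toKT i).D.toDomains) → GaugeY (Matrix (Fin N) (Fin N) ℂ) i),
      (∀ c x, ‖(g c x : Matrix (Fin N) (Fin N) ℂ)‖ ≤ 1 ∧ ‖(((g c x)⁻¹ : (Matrix (Fin N) (Fin N) ℂ)ˣ) : Matrix (Fin N) (Fin N) ℂ)‖ ≤ 1) →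
    ∀ (A : ↥(cubes (toKT i).D.toDomains) → AfldY (Matrix (Fin N) (Fin N) ℂ) i)
      (Q : ↥(cubes (toKT i).D.toDomains) → Set (Site (PV d ℓ i.m i.K hd hL) 0)) (C ξ Λ : ↥(cubes (toKT i).D.toDomains) → ℝ),
      (∀ c, 0 ≤ C c) → (∀ c, 0 < ξ c) → (∀ c, 1 ≤ Λ c) → (∀ c, ξ c ≤ 5 * (SC i c : ℝ) * (kGeo i).eta) →
      (∀ c, LatticeNorms.scaleLen ((ℓ : ℝ) + 1) (kGeo i).eta (c.1.1 + 1) ≤ Λ c * ξ c) →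
      (∀ c, ∀ x : Site (PV d ℓ i.m i.K hd hL) 0, NearC i c (35 * SC i c / 8 + 1) (boxEquiv i.hN x).1 → x ∈ Q c) →
      (∀ c, ∀ (κ : Fin (d + 1)) (x : Site (PV d ℓ i.m i.K hd hL) 0), x ∈ Q c → x.shift κ ∈ Q c →
        gaugeY i (g c) U κ x = fluct (kGeo i).eta (A c) κ x) →
      (∀ c, ∀ κ, ∀ x ∈ Q c, ‖A c κ x‖ ≤ C c * (ξ c)⁻¹) →
      (∀ c, ∀ μ ν, ∀ x ∈ Q c,
        ‖(((kGeo i).eta : ℂ)⁻¹) • covD (shiftsV1 (PV d ℓ i.m i.K hd hL)) (fun _ _ => (1 : (Matrix (Fin N) (Fin N) ℂ)ˣ)) μ (A c ν) x‖ ≤ C c * (ξ c ^ 2)⁻¹) →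
      (∀ c, max (C c) (C c * (1 + D1 thetaProf)) * Λ c ^ 2 ≤ a₁) → (∀ c, max (C c) (C c * (1 + D1 thetaProf)) * Λ c ^ 2 ≤ 1 / 4) →
    ∀ {B : B9.Backgrounds} (cfg : B.Cfg → CfgY (Matrix (Fin N) (Fin N) ℂ) i) (U₁ : B.Cfg), cfg U₁ = U →
      HasMajorant (g := toB6 (geo9K i) (Rr i) (Hp i)) (fun p : BlkY i × ι => ιB p.1)
        (conj b ((etaS i ^ 2 * etaS i ^ 2)⁻¹ • (XinvY i (parKnitY i) (GpY i (parKnitY i)) U).restrictScalars ℝ))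
        (fun a a' => K * ((geo9K i).len a ^ 4)⁻¹ * Real.exp (-(δ * (geo9K i).dist a a'))) := by
  -- p21's supplier (Theorem D's majorants for the data family, FILE 10's `hD` shape) and FILE 11 at Theorem D's constants `(κ_D, δ_D)`
  obtain ⟨δD, κD, MD, TD, ND, hδD, hκD, aD, haD, HD⟩ := hDf_of_cubeData_unitary b hG Rr Hp hℓ hM₂ hrepr
  obtain ⟨δ, K, M₁₁, T₁₁, N₁₁, hδ, hK, a₁₁, ha₁₁, a₀, ha₀, H11⟩ := cinv_at_knit_member_of_cubeData_unitary b hG hGa Rr Hp hℓ hM₂ hrepr hκD hδD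
  refine ⟨δ, K, max MD M₁₁, max TD T₁₁, max ND N₁₁, hδ, hK, min aD a₁₁, lt_min haD ha₁₁, a₀, ha₀, ?_⟩
  intro α₀' hα ha₀' hα3 hα2 i hM hN hT hcf ιB hι U hU h52 g hu A Q C ξ Λ hC0 hξ hΛ hξS hΛξ hQ hgA hA hdA hα₁ hα4 B cfg U₁ hcfg
  -- the thresholds of the two suppliers
  have hMD : MD ≤ ((ℓ : ℝ) + 1) * (toKT i).Mh := (le_max_left _ _).trans hM
  have hM₁₁ : M₁₁ ≤ ((ℓ : ℝ) + 1) * (toKT i).Mh := (le_max_right _ _).trans hM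
  have hND : ND + 1 ≤ (toKT i).R * ((ℓ + 1) * (toKT i).Mh) := (Nat.add_le_add_right (le_max_left _ _) 1).trans hN
  have hN₁₁ : N₁₁ + 1 ≤ (toKT i).R * ((ℓ + 1) * (toKT i).Mh) := (Nat.add_le_add_right (le_max_right _ _) 1).trans hN
  have hTD : TD ≤ RM1 i := (le_max_left _ _).trans hT
  have hT₁₁ : T₁₁ ≤ RM1 i := (le_max_right _ _).trans hT
  have hα₁D : ∀ c, max (C c) (C c * (1 + D1 thetaProf)) * Λ c ^ 2 ≤ aD := fun c => (hα₁ c).trans (min_le_left _ _)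
  have hα₁K : ∀ c, max (C c) (C c * (1 + D1 thetaProf)) * Λ c ^ 2 ≤ a₁₁ := fun c => (hα₁ c).trans (min_le_right _ _)
  exact H11 α₀' hα ha₀' hα3 hα2 i hM₁₁ hN₁₁ hT₁₁ hcf ιB hι U hU h52 g hu A Q C ξ Λ hC0 hξ hΛ hξS hΛξ hQ hgA hA hdA hα₁K hα4 cfg U₁ hcfg
    (HD i hMD hND hTD hcf ιB hι U hU g hu A Q C ξ Λ hC0 hξ hΛ hξS hΛξ hQ hgA hA hdA hα₁D hα4 cfg U₁ hcfg)

end Main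

end Literature.MathematicalPhysics.QuantumFieldTheory.Balaban1983to89.B9Thm32CinvAtKnitLetterOfCubeDataThmD

end
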